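import Mathlib.Analysis.InnerProductSpace.Calculus
import Mathlib.Analysis.Calculus.Deriv.Star
import Mathlib.Analysis.Calculus.Deriv.MeanValue
import Mathlib.Analysis.SpecialFunctions.ExpDeriv
import Mathlib.Data.Matrix.Basic
import HarnessLib

/-!
# K2R `RealisedQuasiStaticCellLaw`, line `floquet-bloch`, stub `stub_lowSectorDecay` (S1D): the frozen ladder functional

Summits-side helper (everything proved; no definitions, no named facts; `--supports stmt-AnomalousDissipation-20446`).
Brick (F2) of the S1D stub plan (cell `ad-ideate`, planner ad-p1 gen 15, `STUB-PLAN-stub_lowSectorDecay.md` §3.1–§3.3):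
a one-parameter Lyapunov functional for the (truncated) Fourier LADDER of one Bloch block of the passive solenoidal
cell problem inside one slot, which certifies a UNIFORM exponential energy decay of the whole block driven by the coupling
of the slow mode to its two neighbours — with constants independent of the truncation.

## Abstract setting (finite-dimensional, any index type `ι`)

State `v : ι → ℂ`, evolution `v' = −Λ (D v + g(s) S v)` with rate `Λ > 0`, `D = diag d` real, `S` a complex
skew-Hermitian matrix (`S K J = −conj (S J K)`), `g(s) ∈ [g_lo, g_hi]`, `0 < g_lo`, and a distinguished SLOW index `o` with

* `S o o = 0`, `γ² := Σ_J ‖S o J‖² ∈ (0, 2]` (the slow mode is coupled; for the tridiagonal ladder `γ² = s₀² + s₋₁²`),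
* `Σ_{K ≠ o} ‖Σ_J S_{oJ} S_{JK}‖² ≤ 4γ²` (second-ring coupling; for the ladder it is `s₀²s₁² + s₋₁²s₋₂² ≤ γ²`),
* `0 ≤ d o ≤ 1` (slow mode: tiny damping), `d J ≥ 1/2` for `J ≠ o`, and `d J ≤ 2` whenever `S o J ≠ 0` (first ring).

Functional: `Φ(v) = ‖v‖² − 2β·Re(conj(v_o)·(S v)_o)` with a FROZEN `β` satisfying `0 < β ≤ g_lo/64`, `β g_hi ≤ 1/64`.

* `ladderFunctional_deriv_le` (pointwise algebra, the heart): along the vector field, `dΦ ≤ −Λ β g_lo γ² ‖v‖²`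
  (Cauchy–Schwarz on the row functional, three Young splits; the antisymmetric exchange drops out of `d‖v‖²`, and the
  second-order term `(S²v)_o = −γ² v_o + (second ring)` supplies the decay of the undamped slow mode);
* `ladderFunctional_equiv`: `|2β Re(conj(v_o)(Sv)_o)| ≤ ‖v‖²/4`, i.e. `(3/4)‖v‖² ≤ Φ(v) ≤ (5/4)‖v‖²`.

The ODE consequence (every `C⁰([a,b]) ∩ C¹((a,b))` trajectory obeys
`‖v(s)‖² ≤ (5/3)·exp(−(4/5)Λβγ²g_lo·(s − a))·‖v(a)‖²`, uniformly in the truncation, with the admissible explicit choice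
`β = min(g_lo, g_hi⁻¹)/64`) is the companion file `…LadderFunctionalDecay.lean` (one scalar Grönwall step on top of the
two theorems here).

The constants are deliberately crude (any explicit positive floor serves the far-sector bookkeeping of S1D, §3.5 of the plan:
the slot length, the Taylor parameter and the pre-stretch cancel in the comparison with the requirement). The continuum
analogue of `Φ` is the hypocoercivity functional `‖f‖² + α⟨∂ₓf, ∂_yf⟩` for shear flows; here everything is finite-dimensional
linear algebra. Deliberately NOT here: the identification of the Galerkin-truncated Bloch block
of `Torus.IsWeakPassiveVectorOn` with this ladder (that is the S1D closer's bookkeeping), and any `N → ∞` passage.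
-/

set_option linter.dupNamespace false -- layout D-0017: `AnomalousDissipation.AnomalousDissipation` repeats by design

namespace Summit.AnomalousDissipation.AnomalousDissipation.Theorems.SolenoidalFractalHomogenisation.RealisedQuasiStaticCellLaw

noncomputable section

open Set Finset Complex
open scoped BigOperators ComplexConjugate

/-! ## Elementary inequalities -/

/-- Cauchy–Schwarz for a finite complex bilinear sum, squared form:
`‖Σ_J f_J w_J‖² ≤ (Σ_J ‖f_J‖²)(Σ_J ‖w_J‖²)`. -/
theorem norm_sum_mul_sq_le {ι : Type*} (s : Finset ι) (f w : ι → ℂ) :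
    ‖∑ J ∈ s, f J * w J‖ ^ 2 ≤ (∑ J ∈ s, ‖f J‖ ^ 2) * ∑ J ∈ s, ‖w J‖ ^ 2 := by
  have h1 : ‖∑ J ∈ s, f J * w J‖ ≤ ∑ J ∈ s, ‖f J‖ * ‖w J‖ :=
    (norm_sum_le _ _).trans (Finset.sum_le_sum fun J _ => (norm_mul_le _ _))
  exact (pow_le_pow_left₀ (norm_nonneg _) h1 2).trans (Finset.sum_mul_sq_le_sq_mul_sq s _ _)

/-- Young's inequality with a weight: `2ab ≤ εa² + b²/ε` for `ε > 0`. -/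
theorem two_mul_le_weighted (a b ε : ℝ) (hε : 0 < ε) : 2 * a * b ≤ ε * a ^ 2 + b ^ 2 / ε := by
  have h : (ε * a - b) ^ 2 / ε = ε * a ^ 2 + b ^ 2 / ε - 2 * a * b := by
    field_simp
    ring
  have h' : 0 ≤ (ε * a - b) ^ 2 / ε := div_nonneg (sq_nonneg _) hε.le
  linarith

/-! ## The skew-Hermitian structure -/

/-- For a skew-Hermitian `S`, the exchange term is purely imaginary: `Re Σ_J conj(v_J) (S v)_J = 0`. -/
theorem re_sum_conj_mul_skew_eq_zero {ι : Type*} [Fintype ι] (S : Matrix ι ι ℂ) (hS : ∀ J K, S K J = -conj (S J K)) (v : ι → ℂ) :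
    (∑ J, conj (v J) * ∑ K, S J K * v K).re = 0 := by
  set A : ℂ := ∑ J, conj (v J) * ∑ K, S J K * v K with hA
  have hconj : ∀ J K, conj (S J K) = -S K J := fun J K => by rw [hS J K, neg_neg]
  have h1 : conj A = ∑ J, ∑ K, v J * (conj (S J K) * conj (v K)) := by
    simp only [hA, map_sum, map_mul, Complex.conj_conj, Finset.mul_sum]
  have h2 : ∑ J, ∑ K, v J * (conj (S J K) * conj (v K)) = ∑ J, ∑ K, -(conj (v K) * (S K J * v J)) := by
    refine Finset.sum_congr rfl fun J _ => Finset.sum_congr rfl fun K _ => ?_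
    rw [hconj J K]
    ring
  have h3 : ∑ J, ∑ K, -(conj (v K) * (S K J * v J)) = -A := by
    rw [Finset.sum_comm]
    simp only [Finset.sum_neg_distrib, hA, Finset.mul_sum]
  have h4 : (conj A).re = (-A).re := by rw [h1, h2, h3]
  rw [Complex.conj_re, Complex.neg_re] at h4
  linarith

/-- Row-`o` of `S²`: `Σ_J S_{oJ} (S v)_J = Σ_K (Σ_J S_{oJ} S_{JK}) v_K`. -/
theorem row_mul_mulVec {ι : Type*} [Fintype ι] (S : Matrix ι ι ℂ) (o : ι) (v : ι → ℂ) :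
    ∑ J, S o J * ∑ K, S J K * v K = ∑ K, (∑ J, S o J * S J K) * v K := by
  simp only [Finset.mul_sum, Finset.sum_mul, mul_assoc]
  rw [Finset.sum_comm]

/-- The diagonal entry of `S²` at `o` is `−γ²`: `Σ_J S_{oJ} S_{Jo} = −Σ_J ‖S_{oJ}‖²` for skew-Hermitian `S`. -/
theorem row_mul_col_self {ι : Type*} [Fintype ι] (S : Matrix ι ι ℂ) (hS : ∀ J K, S K J = -conj (S J K)) (o : ι) :
    ∑ J, S o J * S J o = -((∑ J, ‖S o J‖ ^ 2 : ℝ) : ℂ) := by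
  push_cast
  rw [← Finset.sum_neg_distrib]
  refine Finset.sum_congr rfl fun J _ => ?_
  rw [hS o J, mul_neg, Complex.mul_conj']

/-! ## The heart: the derivative of the functional along the vector field -/

/-- **Pointwise dissipation inequality for the frozen ladder functional.** In the abstract setting of the module
docstring, for every state `v` and every coupling value `g ∈ [g_lo, g_hi]`, writing `F = −Λ(Dv + gSv)` for the vector
field and `ℓ(w) = (S w)_o` for the slow row, the derivative of `Φ(v) = Σ‖v_J‖² − 2β Re(conj(v_o) ℓ(v))` along `F`,
namely `Σ_J 2Re(conj(v_J) F_J) − 2β(Re(conj(F_o) ℓ(v)) + Re(conj(v_o) ℓ(F)))`, is at most `−Λ β g_lo γ² Σ‖v_J‖²`. -/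
theorem ladderFunctional_deriv_le {ι : Type*} [Fintype ι] [DecidableEq ι] (S : Matrix ι ι ℂ) (d : ι → ℝ) (o : ι) (Λ g_lo g_hi g β γ2 : ℝ) (v F : ι → ℂ)
    (hS : ∀ J K, S K J = -conj (S J K)) (hSo : S o o = 0) (hγ : γ2 = ∑ J, ‖S o J‖ ^ 2)
    (hγpos : 0 < γ2) (hγ2 : γ2 ≤ 2)
    (hρ : ∑ K ∈ univ.erase o, ‖∑ J, S o J * S J K‖ ^ 2 ≤ 4 * γ2)
    (hdo : 0 ≤ d o) (hdo1 : d o ≤ 1) (hd : ∀ J, J ≠ o → 1 / 2 ≤ d J) (hd1 : ∀ J, S o J ≠ 0 → d J ≤ 2)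
    (hΛ : 0 < Λ) (hglo : 0 < g_lo) (hg : g_lo ≤ g) (hg' : g ≤ g_hi)
    (hβ : 0 < β) (hβ1 : β ≤ g_lo / 64) (hβ2 : β * g_hi ≤ 1 / 64)
    (hF : ∀ J, F J = -(Λ : ℂ) * ((d J : ℂ) * v J + (g : ℂ) * ∑ K, S J K * v K)) :
    (∑ J, 2 * (conj (v J) * F J).re) -
        2 * β * ((conj (F o) * ∑ J, S o J * v J).re + (conj (v o) * ∑ J, S o J * F J).re) ≤
      -(Λ * β * g_lo * γ2) * ∑ J, ‖v J‖ ^ 2 := by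
  -- names
  set ℓv : ℂ := ∑ J, S o J * v J with hℓv
  set ℓDv : ℂ := ∑ J ∈ univ.erase o, (S o J * (d J : ℂ)) * v J with hℓDv
  set u : ℂ := ∑ K ∈ univ.erase o, (∑ J, S o J * S J K) * v K with hu
  set A : ℂ := ∑ J, conj (v J) * ∑ K, S J K * v K with hA
  set X : ℝ := ∑ J, d J * ‖v J‖ ^ 2 with hX
  set E : ℝ := ∑ J, ‖v J‖ ^ 2 with hE
  set Z2 : ℝ := ∑ J ∈ univ.erase o, ‖v J‖ ^ 2 with hZ2
  set a : ℝ := ‖v o‖ with ha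
  have hgpos : 0 < g := lt_of_lt_of_le hglo hg
  have hEsplit : E = a ^ 2 + Z2 := by
    rw [hE, hZ2, ha, ← Finset.add_sum_erase _ _ (Finset.mem_univ o)]
  have hZ2nn : 0 ≤ Z2 := Finset.sum_nonneg fun J _ => by positivity
  -- (I1) the energy part: Σ conj(v_J) F_J = −Λ (X + g A), and Re A = 0
  have hA0 : A.re = 0 := re_sum_conj_mul_skew_eq_zero S hS v
  have hI1 : ∑ J, conj (v J) * F J = -(Λ : ℂ) * ((X : ℂ) + (g : ℂ) * A) := by
    have hpt : ∀ J, conj (v J) * F J =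
        -(Λ : ℂ) * (((d J * ‖v J‖ ^ 2 : ℝ) : ℂ) + (g : ℂ) * (conj (v J) * ∑ K, S J K * v K)) := by
      intro J
      rw [hF J]
      push_cast
      rw [← Complex.conj_mul']
      ring
    rw [Finset.sum_congr rfl fun J _ => hpt J, ← Finset.mul_sum, Finset.sum_add_distrib, ← Finset.mul_sum, hX]
    push_cast
    rfl
  have hE' : ∑ J, 2 * (conj (v J) * F J).re = -2 * Λ * X := by
    rw [← Finset.mul_sum, ← Complex.re_sum, hI1]
    simp only [neg_mul, Complex.neg_re, Complex.re_ofReal_mul, Complex.add_re, Complex.ofReal_re, hA0,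
      mul_zero, add_zero]
    ring
  -- (I2) the slow component of the field
  have hFo : F o = -(Λ : ℂ) * ((d o : ℂ) * v o + (g : ℂ) * ℓv) := hF o
  -- (I3) the slow row of the field: ℓ(F) = −Λ (ℓ(Dv) + g (−γ² v_o + u))
  have hrow : ∑ J, S o J * ∑ K, S J K * v K = -(γ2 : ℂ) * v o + u := by
    rw [row_mul_mulVec, ← Finset.add_sum_erase _ _ (Finset.mem_univ o), row_mul_col_self S hS o, ← hγ]
  have hℓDv' : ∑ J, S o J * ((d J : ℂ) * v J) = ℓDv := by
    rw [hℓDv, ← Finset.add_sum_erase _ _ (Finset.mem_univ o), hSo]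
    simp only [zero_mul, zero_add]
    exact Finset.sum_congr rfl fun J _ => by ring
  have hI3 : ∑ J, S o J * F J = -(Λ : ℂ) * (ℓDv + (g : ℂ) * (-(γ2 : ℂ) * v o + u)) := by
    have hpt : ∀ J, S o J * F J =
        -(Λ : ℂ) * (S o J * ((d J : ℂ) * v J) + (g : ℂ) * (S o J * ∑ K, S J K * v K)) := by
      intro J; rw [hF J]; ring
    rw [Finset.sum_congr rfl fun J _ => hpt J, ← Finset.mul_sum, Finset.sum_add_distrib, ← Finset.mul_sum,
      hℓDv', hrow]
  -- the three real numbers entering the cross term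
  set ψ : ℝ := (conj (v o) * ℓv).re with hψ
  have hcross : (conj (F o) * ∑ J, S o J * v J).re + (conj (v o) * ∑ J, S o J * F J).re =
      -Λ * (d o * ψ + g * ‖ℓv‖ ^ 2 + (conj (v o) * ℓDv).re - g * γ2 * a ^ 2 + g * (conj (v o) * u).re) := by
    rw [← hℓv, hI3, hFo]
    have hc : conj ℓv * ℓv = ((‖ℓv‖ ^ 2 : ℝ) : ℂ) := by
      rw [Complex.conj_mul']
      push_cast
      ring
    have e1 : conj (-(Λ : ℂ) * ((d o : ℂ) * v o + (g : ℂ) * ℓv)) * ℓv =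
        -(Λ : ℂ) * ((d o : ℂ) * (conj (v o) * ℓv) + (g : ℂ) * ((‖ℓv‖ ^ 2 : ℝ) : ℂ)) := by
      simp only [map_mul, map_neg, map_add, Complex.conj_ofReal]
      rw [← hc]
      ring
    have e2 : conj (v o) * (-(Λ : ℂ) * (ℓDv + (g : ℂ) * (-(γ2 : ℂ) * v o + u))) =
        -(Λ : ℂ) * ((conj (v o) * ℓDv) - (g : ℂ) * (γ2 : ℂ) * ((a ^ 2 : ℝ) : ℂ) + (g : ℂ) * (conj (v o) * u)) := by
      rw [ha]
      push_cast
      rw [← Complex.conj_mul']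
      ring
    rw [e1, e2]
    simp only [neg_mul, Complex.neg_re, Complex.add_re, Complex.sub_re, Complex.re_ofReal_mul,
      Complex.ofReal_re, hψ]
    have : ((g : ℂ) * (γ2 : ℂ) * ((a ^ 2 : ℝ) : ℂ)).re = g * γ2 * a ^ 2 := by
      rw [← Complex.ofReal_mul, ← Complex.ofReal_mul, Complex.ofReal_re]
    rw [this]
    ring
  -- bounds on the pieces
  have hX : d o * a ^ 2 + Z2 / 2 ≤ X := by
    rw [hX, ← Finset.add_sum_erase _ _ (Finset.mem_univ o), ← ha, hZ2, Finset.sum_div]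
    refine add_le_add le_rfl (Finset.sum_le_sum fun J hJ => ?_)
    have := hd J (Finset.ne_of_mem_erase hJ)
    have h0 : 0 ≤ ‖v J‖ ^ 2 := by positivity
    nlinarith
  have hγ' : ∑ J ∈ univ.erase o, ‖S o J‖ ^ 2 = γ2 := by
    rw [hγ, ← Finset.add_sum_erase _ _ (Finset.mem_univ o), hSo]
    simp
  have hℓv_sq : ‖ℓv‖ ^ 2 ≤ γ2 * Z2 := by
    have : ℓv = ∑ J ∈ univ.erase o, S o J * v J := by
      rw [hℓv, ← Finset.add_sum_erase _ _ (Finset.mem_univ o), hSo]; simp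
    rw [this, ← hγ', hZ2]
    exact norm_sum_mul_sq_le _ _ _
  have hℓDv_sq : ‖ℓDv‖ ^ 2 ≤ 4 * γ2 * Z2 := by
    refine (norm_sum_mul_sq_le _ _ _).trans ?_
    have hsum : ∑ J ∈ univ.erase o, ‖S o J * (d J : ℂ)‖ ^ 2 ≤ 4 * γ2 := by
      rw [← hγ', Finset.mul_sum]
      refine Finset.sum_le_sum fun J _ => ?_
      rw [norm_mul, mul_pow, Complex.norm_real, Real.norm_eq_abs, sq_abs]
      by_cases hJ : S o J = 0
      · simp [hJ]
      · have h2 := hd1 J hJ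
        have hJo : J ≠ o := fun h => hJ (h ▸ hSo)
        have h1 := hd J hJo
        have : d J ^ 2 ≤ 4 := by nlinarith
        have h0 : 0 ≤ ‖S o J‖ ^ 2 := by positivity
        nlinarith
    exact mul_le_mul_of_nonneg_right hsum hZ2nn
  have hu_sq : ‖u‖ ^ 2 ≤ 4 * γ2 * Z2 :=
    (norm_sum_mul_sq_le _ _ _).trans (mul_le_mul_of_nonneg_right hρ hZ2nn)
  -- Young splits
  have hψ_abs : |ψ| ≤ a * ‖ℓv‖ := by
    rw [hψ, ha]; exact (Complex.abs_re_le_norm _).trans_eq (by rw [norm_mul, Complex.norm_conj])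
  have hT1 : 2 * β * (d o * ψ) ≤ d o * a ^ 2 + β ^ 2 * d o * (γ2 * Z2) := by
    have h1 : d o * ψ ≤ d o * (a * ‖ℓv‖) := mul_le_mul_of_nonneg_left (le_of_abs_le hψ_abs) hdo
    have h2 : 2 * a * (β * ‖ℓv‖) ≤ a ^ 2 + (β * ‖ℓv‖) ^ 2 := two_mul_le_add_sq _ _
    have h3 : (β * ‖ℓv‖) ^ 2 ≤ β ^ 2 * (γ2 * Z2) := by
      rw [mul_pow]; exact mul_le_mul_of_nonneg_left hℓv_sq (sq_nonneg _)
    have h1' := mul_le_mul_of_nonneg_left h1 (by positivity : (0:ℝ) ≤ 2 * β)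
    have h2' := mul_le_mul_of_nonneg_left (h2.trans (add_le_add le_rfl h3)) hdo
    have e : 2 * β * (d o * (a * ‖ℓv‖)) = d o * (2 * a * (β * ‖ℓv‖)) := by ring
    linarith
  have hT2 : 2 * β * (g * ‖ℓv‖ ^ 2) ≤ 2 * β * g * (γ2 * Z2) := by
    have := mul_le_mul_of_nonneg_left hℓv_sq (by positivity : 0 ≤ 2 * β * g)
    linarith
  have hε : 0 < β * g * γ2 / 2 := by positivity
  have hT3 : 2 * β * (conj (v o) * ℓDv).re ≤ β * g * γ2 / 2 * a ^ 2 + 8 * β / g * Z2 := by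
    have h1 : (conj (v o) * ℓDv).re ≤ a * ‖ℓDv‖ := by
      rw [ha]; exact le_of_abs_le ((Complex.abs_re_le_norm _).trans_eq (by rw [norm_mul, Complex.norm_conj]))
    have h2 := two_mul_le_weighted a (β * ‖ℓDv‖) (β * g * γ2 / 2) hε
    have h3 : (β * ‖ℓDv‖) ^ 2 / (β * g * γ2 / 2) ≤ 8 * β / g * Z2 := by
      rw [div_le_iff₀ hε, mul_pow]
      have := mul_le_mul_of_nonneg_left hℓDv_sq (sq_nonneg β)
      have h8 : 8 * β / g * Z2 * (β * g * γ2 / 2) = β ^ 2 * (4 * γ2 * Z2) := by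
        field_simp
        ring
      rw [h8]
      exact this
    have h1' := mul_le_mul_of_nonneg_left h1 (by positivity : (0:ℝ) ≤ 2 * β)
    have e : 2 * β * (a * ‖ℓDv‖) = 2 * a * (β * ‖ℓDv‖) := by ring
    linarith
  have hT4 : 2 * β * (g * (conj (v o) * u).re) ≤ β * g * γ2 / 2 * a ^ 2 + 8 * β * g * Z2 := by
    have h1 : (conj (v o) * u).re ≤ a * ‖u‖ := by
      rw [ha]; exact le_of_abs_le ((Complex.abs_re_le_norm _).trans_eq (by rw [norm_mul, Complex.norm_conj]))
    have h2 := two_mul_le_weighted a (β * g * ‖u‖) (β * g * γ2 / 2) hε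
    have h3 : (β * g * ‖u‖) ^ 2 / (β * g * γ2 / 2) ≤ 8 * β * g * Z2 := by
      rw [div_le_iff₀ hε, mul_pow]
      have := mul_le_mul_of_nonneg_left hu_sq (sq_nonneg (β * g))
      have h8 : 8 * β * g * Z2 * (β * g * γ2 / 2) = (β * g) ^ 2 * (4 * γ2 * Z2) := by ring
      rw [h8]
      exact this
    have h1' : g * (conj (v o) * u).re ≤ g * (a * ‖u‖) := mul_le_mul_of_nonneg_left h1 hgpos.le
    have h1'' := mul_le_mul_of_nonneg_left h1' (by positivity : (0:ℝ) ≤ 2 * β)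
    have e : 2 * β * (g * (a * ‖u‖)) = 2 * a * (β * g * ‖u‖) := by ring
    linarith
  -- numerical budget
  have hβ64 : β ≤ 1 / 64 := by
    have h1 : β * g_lo ≤ 1 / 64 := (mul_le_mul_of_nonneg_left (hg.trans hg') hβ.le).trans hβ2
    by_cases hg1 : g_lo ≤ 1
    · linarith
    · have : β * 1 ≤ β * g_lo := mul_le_mul_of_nonneg_left (not_le.mp hg1).le hβ.le
      linarith
  have hβg : β * g ≤ 1 / 64 := (mul_le_mul_of_nonneg_left hg' hβ.le).trans hβ2
  have hc1 : β ^ 2 * d o * γ2 ≤ 1 / 2048 := by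
    have : β ^ 2 ≤ (1 / 64) ^ 2 := pow_le_pow_left₀ hβ.le hβ64 2
    have h2 : β ^ 2 * d o ≤ (1 / 64) ^ 2 * 1 := mul_le_mul this hdo1 hdo (by positivity)
    have h3 : β ^ 2 * d o * γ2 ≤ (1 / 64) ^ 2 * 1 * 2 := mul_le_mul h2 hγ2 hγpos.le (by positivity)
    linarith
  have hc2 : 2 * β * g * γ2 ≤ 1 / 16 := by
    have h3 : β * g * γ2 ≤ 1 / 64 * 2 := mul_le_mul hβg hγ2 hγpos.le (by positivity)
    linarith
  have hc3 : 8 * β / g ≤ 1 / 8 := by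
    rw [div_le_iff₀ hgpos]
    linarith
  have hc4 : 8 * β * g ≤ 1 / 8 := by linarith
  have hc5 : β * g_lo * γ2 ≤ 1 / 2 := by
    have : β * g_lo ≤ 1 / 64 := (mul_le_mul_of_nonneg_left (hg.trans hg') hβ.le).trans hβ2
    have h3 : β * g_lo * γ2 ≤ 1 / 64 * 2 := mul_le_mul this hγ2 hγpos.le (by positivity)
    linarith
  have hc6 : β * g_lo * γ2 ≤ β * g * γ2 :=
    mul_le_mul_of_nonneg_right (mul_le_mul_of_nonneg_left hg hβ.le) hγpos.le
  -- assemble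
  rw [hE', hcross]
  have ha2 : 0 ≤ a ^ 2 := sq_nonneg _
  have hkey : -2 * X + 2 * β * (d o * ψ + g * ‖ℓv‖ ^ 2 + (conj (v o) * ℓDv).re - g * γ2 * a ^ 2 +
      g * (conj (v o) * u).re) ≤ -(β * g_lo * γ2) * (a ^ 2 + Z2) := by
    have hZ : (β ^ 2 * d o * γ2 + 2 * β * g * γ2 + 8 * β / g + 8 * β * g) * Z2 ≤ (1 / 2) * Z2 :=
      mul_le_mul_of_nonneg_right (by linarith) hZ2nn
    have p1 := mul_le_mul_of_nonneg_right hc6 ha2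
    have p2 := mul_le_mul_of_nonneg_right hc5 hZ2nn
    have p3 := mul_nonneg hdo ha2
    have e : 2 * β * (d o * ψ + g * ‖ℓv‖ ^ 2 + (conj (v o) * ℓDv).re - g * γ2 * a ^ 2 +
        g * (conj (v o) * u).re) = 2 * β * (d o * ψ) + 2 * β * (g * ‖ℓv‖ ^ 2) +
        2 * β * (conj (v o) * ℓDv).re - 2 * (β * g * γ2) * a ^ 2 + 2 * β * (g * (conj (v o) * u).re) := by ring
    rw [e]
    linarith
  have : -2 * Λ * X - 2 * β * (-Λ * (d o * ψ + g * ‖ℓv‖ ^ 2 + (conj (v o) * ℓDv).re - g * γ2 * a ^ 2 +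
      g * (conj (v o) * u).re)) = Λ * (-2 * X + 2 * β * (d o * ψ + g * ‖ℓv‖ ^ 2 + (conj (v o) * ℓDv).re -
      g * γ2 * a ^ 2 + g * (conj (v o) * u).re)) := by ring
  rw [this, hEsplit, show -(Λ * β * g_lo * γ2) * (a ^ 2 + Z2) = Λ * (-(β * g_lo * γ2) * (a ^ 2 + Z2)) by ring]
  exact mul_le_mul_of_nonneg_left hkey hΛ.le

/-- **Equivalence of the functional with the energy**: `|2β Re(conj(v_o)(Sv)_o)| ≤ ‖v‖²/4`, hence
`(3/4)‖v‖² ≤ Φ(v) ≤ (5/4)‖v‖²`, whenever `β ≤ 1/64` and `γ² ≤ 2`. -/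
theorem ladderFunctional_equiv {ι : Type*} [Fintype ι] [DecidableEq ι] (S : Matrix ι ι ℂ) (o : ι) (β γ2 : ℝ) (v : ι → ℂ)
    (hSo : S o o = 0) (hγ : γ2 = ∑ J, ‖S o J‖ ^ 2) (hγ2 : γ2 ≤ 2) (hβ : 0 ≤ β) (hβ64 : β ≤ 1 / 64) :
    |2 * β * (conj (v o) * ∑ J, S o J * v J).re| ≤ (1 / 4) * ∑ J, ‖v J‖ ^ 2 := by
  set ℓv : ℂ := ∑ J, S o J * v J with hℓv
  set Z2 : ℝ := ∑ J ∈ univ.erase o, ‖v J‖ ^ 2 with hZ2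
  have hEsplit : ∑ J, ‖v J‖ ^ 2 = ‖v o‖ ^ 2 + Z2 := by
    rw [hZ2, ← Finset.add_sum_erase _ _ (Finset.mem_univ o)]
  have hZ2nn : 0 ≤ Z2 := Finset.sum_nonneg fun J _ => by positivity
  have hγ' : ∑ J ∈ univ.erase o, ‖S o J‖ ^ 2 = γ2 := by
    rw [hγ, ← Finset.add_sum_erase _ _ (Finset.mem_univ o), hSo]; simp
  have hℓv_sq : ‖ℓv‖ ^ 2 ≤ γ2 * Z2 := by
    have : ℓv = ∑ J ∈ univ.erase o, S o J * v J := by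
      rw [hℓv, ← Finset.add_sum_erase _ _ (Finset.mem_univ o), hSo]; simp
    rw [this, ← hγ', hZ2]
    exact norm_sum_mul_sq_le _ _ _
  have h1 : |(conj (v o) * ℓv).re| ≤ ‖v o‖ * ‖ℓv‖ :=
    (Complex.abs_re_le_norm _).trans_eq (by rw [norm_mul, Complex.norm_conj])
  have h2 : 2 * ‖v o‖ * ‖ℓv‖ ≤ ‖v o‖ ^ 2 + ‖ℓv‖ ^ 2 := two_mul_le_add_sq _ _
  rw [abs_mul, abs_of_nonneg (by positivity : (0:ℝ) ≤ 2 * β), hEsplit]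
  have h3 : ‖ℓv‖ ^ 2 ≤ 2 * Z2 := hℓv_sq.trans (mul_le_mul_of_nonneg_right hγ2 hZ2nn)
  have h0 : 0 ≤ ‖v o‖ ^ 2 := sq_nonneg _
  nlinarith [mul_le_mul_of_nonneg_left (h1.trans (by nlinarith : ‖v o‖ * ‖ℓv‖ ≤ (‖v o‖ ^ 2 + 2 * Z2)))
    (by positivity : (0:ℝ) ≤ 2 * β)]

end

end Summit.AnomalousDissipation.AnomalousDissipation.Theorems.SolenoidalFractalHomogenisation.RealisedQuasiStaticCellLaw
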